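import Summits.AtomisticToContinuum.FouriersLaw.Theorems.VanishingNoiseTransferNoiseLocalityStubResponseDensityNoisyDyson7

/-!
# Flip-noisy response density, step 8: the EXACT response identity of the flip-noisy steady state
(helpers for stub `stub_responseDensityNoisy`)

Helper file `--supports stmt-AtomisticToContinuum-11975` (crux `NoiseLocality`, route
`VanishingNoiseTransfer`, line `relative-flip-energy-transfer`, stub 1b `stub_responseDensityNoisy`),
namespace `…NoiseLocality.StubResponseDensityNoisy.Dyson`.

Baths at `T ± δ/2` (`|δ| < T`), rate `r > 0`; `R = R_r`, `K = Q ∘ₖ R`, `π` an invariant probability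
measure of `K`, so that `μ = π R` is the weak flip steady state of the embedded-chain construction
(`VelocityFlipEmbeddedChainSteadyState.lean`); `π_T` the Gibbs measure at the mean temperature,
`g = p_0² - p_{N-1}²`, `c = γ/(2T²)`. For continuous `φ` with `|φ| ≤ C e^{ϑH}` and `ψ = R φ`:

  `μ(φ) - π_T(φ) = δ c r⁻¹ ∑ₙ π_T(g · Kⁿ ψ)`            (`exact_response_identity`)

— an EXACT, non-perturbative identity; the series converges geometrically with constants uniform in
`δ`. Proof: the Poisson equation `χ - Kχ = ψ - π(ψ)` of `…Dyson7` integrated against `π_T`,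
`π_T(Q χ) = π_T(χ)`, and the resolvent response identity (`rri_gibbs`) applied to `Q χ` and to `φ`:
all `δ`-dependence of the DETERMINISTIC resolvent kernels is absorbed exactly, `π_T(g) = 0` kills the
centring terms.

No definitions.
-/

noncomputable section

open MeasureTheory ProbabilityTheory Filter Topology Set
open scoped NNReal ENNReal

namespace Summit.AtomisticToContinuum.FouriersLaw.Theorems.NoiseLocality.StubResponseDensityNoisy.Dyson

open Literature.MathematicalPhysics.KineticTheory.HeatConduction
open Literature.Probability.Process Literature.MathematicalPhysics.KineticTheory OscillatorChain

section Exact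

variable {N : ℕ} {ω₂ lam β γ : ℝ} (hω : 0 < ω₂) (hl : 0 < lam) (hβ : 0 < β) (hγ : 0 < γ) (hN : 0 < N)
  {T : ℝ} (hT : 0 < T) {ϑ : ℝ} (hϑ : 0 < ϑ) (h2ϑT : 2 * ϑ < 1 / (2 * T)) {r : ℝ} (hr : 0 < r)
include hω hl hβ hγ hN hT hϑ h2ϑT hr

set_option maxHeartbeats 1600000 in
/-- **The exact response identity of the flip-noisy steady state.** There are `ᾱ ∈ (0,1)` and
`C_B ≥ 0` (uniform in `δ`) such that for every `|δ| < T`, every invariant probability measure `π` of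
the embedded flip chain `K` with baths at `T ± δ/2`, and every continuous `φ` with `|φ| ≤ C e^{ϑH}`
(`C ≥ 0`), writing `ψ = R φ` and `aₙ = π_T((p_0² - p_{N-1}²) · Kⁿ ψ)`:
`|aₙ| ≤ C_B C ᾱⁿ`, and `(π R)(φ) - π_T(φ) = δ (γ/2T²) r⁻¹ ∑ₙ aₙ`. -/
theorem exact_response_identity :
    ∃ abar CB : ℝ, 0 < abar ∧ abar < 1 ∧ 0 ≤ CB ∧
      ∀ (δ : ℝ) (hδ : |δ| < T) (π : Measure (PhaseSpace N)), IsProbabilityMeasure π →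
        Kernel.Invariant ((pinnedChainSemigroup hω hl.le hβ.le hγ.le hN
          ((half_pos hT).le.trans (bath_window hT hδ).2.2.2.2.1) ((half_pos hT).le.trans (bath_window hT hδ).2.2.2.2.2)).embeddedFlipKernel r) π →
        ∀ (φ : PhaseSpace N → ℝ), Continuous φ → ∀ (C : ℝ), 0 ≤ C →
          (∀ y, |φ y| ≤ C * Real.exp (ϑ * (pinnedChain ω₂ lam β γ).hamiltonian N y)) →
          (∀ n : ℕ, |∫ x, (x.2 ⟨0, hN⟩ ^ 2 - x.2 ⟨N - 1, by omega⟩ ^ 2) *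
              (∫ y, (∫ z, φ z ∂((pinnedChainSemigroup hω hl.le hβ.le hγ.le hN
                ((half_pos hT).le.trans (bath_window hT hδ).2.2.2.2.1) ((half_pos hT).le.trans (bath_window hT hδ).2.2.2.2.2)).resolventKernel r y))
                ∂((((pinnedChainSemigroup hω hl.le hβ.le hγ.le hN
                  ((half_pos hT).le.trans (bath_window hT hδ).2.2.2.2.1) ((half_pos hT).le.trans (bath_window hT hδ).2.2.2.2.2)).embeddedFlipKernel r) ^ n) x))
              ∂((pinnedChain ω₂ lam β γ).gibbsMeasure N T)| ≤ CB * C * abar ^ n) ∧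
          (∫ x, φ x ∂(π.bind ((pinnedChainSemigroup hω hl.le hβ.le hγ.le hN
              ((half_pos hT).le.trans (bath_window hT hδ).2.2.2.2.1) ((half_pos hT).le.trans (bath_window hT hδ).2.2.2.2.2)).resolventKernel r))) -
            ∫ x, φ x ∂((pinnedChain ω₂ lam β γ).gibbsMeasure N T) =
            δ * (γ / (2 * T ^ 2)) * r⁻¹ * ∑' n : ℕ, ∫ x, (x.2 ⟨0, hN⟩ ^ 2 - x.2 ⟨N - 1, by omega⟩ ^ 2) *
              (∫ y, (∫ z, φ z ∂((pinnedChainSemigroup hω hl.le hβ.le hγ.le hN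
                ((half_pos hT).le.trans (bath_window hT hδ).2.2.2.2.1) ((half_pos hT).le.trans (bath_window hT hδ).2.2.2.2.2)).resolventKernel r y))
                ∂((((pinnedChainSemigroup hω hl.le hβ.le hγ.le hN
                  ((half_pos hT).le.trans (bath_window hT hδ).2.2.2.2.1) ((half_pos hT).le.trans (bath_window hT hδ).2.2.2.2.2)).embeddedFlipKernel r) ^ n) x))
              ∂((pinnedChain ω₂ lam β γ).gibbsMeasure N T) := by
  have hHc : Continuous ((pinnedChain ω₂ lam β γ).hamiltonian N) := pinnedChain_continuous_hamiltonian ω₂ lam β γ N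
  have hϑT : ϑ < 1 / (2 * T) := theta_lt_of_two_theta_lt hϑ h2ϑT
  haveI := pinnedChain_isProbabilityMeasure_gibbsMeasure hω hl.le hβ.le γ N hT
  -- uniform constants
  obtain ⟨abar, Cπ, Cg, h0, h1, hCπ, hCg, hP⟩ := poisson_embeddedFlipKernel hω hl hβ hγ hN hT hϑ h2ϑT hr
  obtain ⟨_c, _B, a, b, _hc, _hB, ha, hb, hunif⟩ := lintegral_exp_kernel_resolventKernel_le_unif hω hl hβ hγ hN hT hϑ hϑT hr
  obtain ⟨Cp, hCp, hpow⟩ := lintegral_exp_embeddedFlipKernel_pow_le_unif hω hl hβ hγ hN hT hϑ hϑT hr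
  obtain ⟨hIg, hgf⟩ := integrable_gibbs_oddMoment_mul hω hl hβ hN hT h2ϑT (γ := γ) (ϑ := ϑ)
  set Ig : ℝ := ∫ x, (1 + x.2 ⟨0, hN⟩ ^ 2 + x.2 ⟨N - 1, by omega⟩ ^ 2) * Real.exp (ϑ * (pinnedChain ω₂ lam β γ).hamiltonian N x)
    ∂((pinnedChain ω₂ lam β γ).gibbsMeasure N T) with hIgdef
  have hIg0 : 0 ≤ Ig := integral_nonneg fun x => by positivity
  set CR : ℝ := a.toReal + b.toReal with hCR
  have hCR0 : 0 ≤ CR := by positivity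
  refine ⟨abar, Cg * CR * Ig, h0, h1, by positivity, fun δ hδ π hπ hinv φ hφ C hC hφb => ?_⟩
  haveI := hπ
  obtain ⟨hL0, hL', hR0, hR', hL2, hR2⟩ := bath_window hT hδ
  set Sg := pinnedChainSemigroup hω hl.le hβ.le hγ.le hN ((half_pos hT).le.trans (bath_window hT hδ).2.2.2.2.1)
    ((half_pos hT).le.trans (bath_window hT hδ).2.2.2.2.2) with hSg
  set Rk := Sg.resolventKernel r with hRk
  set K := Sg.embeddedFlipKernel r with hK
  haveI : IsMarkovKernel Rk := Sg.isMarkovKernel_resolventKernel hr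
  haveI : IsMarkovKernel K := Sg.isMarkovKernel_embeddedFlipKernel hr
  haveI : ∀ m : ℕ, IsMarkovKernel (K ^ m) := fun m => Harris.isMarkovKernel_pow _ m
  have hRes : ∀ z : PhaseSpace N, ∫⁻ y, ENNReal.ofReal (Real.exp (ϑ * (pinnedChain ω₂ lam β γ).hamiltonian N y)) ∂(Rk z) ≤
      a * ENNReal.ofReal (Real.exp (ϑ * (pinnedChain ω₂ lam β γ).hamiltonian N z)) + b := (hunif _ _ hL0 hL' hR0 hR').2
  have hpowK : ∀ (n : ℕ) (x : PhaseSpace N), ∫⁻ y, ENNReal.ofReal (Real.exp (ϑ * (pinnedChain ω₂ lam β γ).hamiltonian N y))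
      ∂((K ^ n) x) ≤ ENNReal.ofReal (Real.exp (ϑ * (pinnedChain ω₂ lam β γ).hamiltonian N x)) + Cp :=
    fun n x => hpow _ _ hL0 hL' hR0 hR' n x
  have hWm : Measurable fun z => Real.exp (ϑ * (pinnedChain ω₂ lam β γ).hamiltonian N z) :=
    (Real.continuous_exp.comp (continuous_const.mul hHc)).measurable
  have hW1 : ∀ x, (1 : ℝ) ≤ Real.exp (ϑ * (pinnedChain ω₂ lam β γ).hamiltonian N x) := fun x =>
    Real.one_le_exp (mul_nonneg hϑ.le (pinnedChain_hamiltonian_nonneg hω.le hl.le hβ.le γ N x))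
  -- generic weighted facts at these temperatures
  have hRfacts : ∀ {f : PhaseSpace N → ℝ}, Continuous f → ∀ {Cf : ℝ}, 0 ≤ Cf →
      (∀ y, |f y| ≤ Cf * Real.exp (ϑ * (pinnedChain ω₂ lam β γ).hamiltonian N y)) →
      (∀ x, Integrable f (Rk x)) ∧ (Continuous fun x => ∫ y, f y ∂(Rk x)) ∧
        ∀ x, |∫ y, f y ∂(Rk x)| ≤ Cf * CR * Real.exp (ϑ * (pinnedChain ω₂ lam β γ).hamiltonian N x) := by
    intro f hf Cf hCf hfb
    have hwin : ∀ _y : Unit, 0 < T + δ / 2 ∧ T + δ / 2 ≤ 2 * T ∧ 0 < T - δ / 2 ∧ T - δ / 2 ≤ 2 * T :=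
      fun _ => ⟨hL0, hL', hR0, hR'⟩
    have h := (continuous_integral_resolventKernel_param hω hl hβ hγ hN hT hϑ h2ϑT (Y := Unit)
      (τL := fun _ => T + δ / 2) (τR := fun _ => T - δ / 2) continuous_const continuous_const hwin (F := fun _ => f)
      (hf.comp continuous_snd) hCf (fun _ y => hfb y) hr).2
    have hu : Continuous fun x : PhaseSpace N => ((), x) := (continuous_const (y := ())).prodMk continuous_id
    have h2 := h.comp hu
    refine ⟨fun x => ?_, h2, fun x => ?_⟩
    · exact (integrable_abs_integral_le_of_lintegral_le hWm (fun z => (Real.exp_pos _).le)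
        (ENNReal.add_ne_top.2 ⟨ENNReal.mul_ne_top ha.ne_top ENNReal.ofReal_ne_top, hb⟩) (hRes x)
        hf.aestronglyMeasurable hCf hfb).1
    · have h3 := (integrable_abs_integral_le_of_lintegral_le hWm (fun z => (Real.exp_pos _).le)
        (ENNReal.add_ne_top.2 ⟨ENNReal.mul_ne_top ha.ne_top ENNReal.ofReal_ne_top, hb⟩) (hRes x)
        hf.aestronglyMeasurable hCf hfb).2
      rw [toReal_affine ha.ne_top hb (Real.exp_pos _).le] at h3
      refine h3.trans ?_
      have := ENNReal.toReal_nonneg (a := a); have := ENNReal.toReal_nonneg (a := b)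
      nlinarith [hW1 x, mul_nonneg hCf (ENNReal.toReal_nonneg (a := b))]
  have hKfacts : ∀ {f : PhaseSpace N → ℝ}, Continuous f → ∀ {Cf : ℝ}, 0 ≤ Cf →
      (∀ y, |f y| ≤ Cf * Real.exp (ϑ * (pinnedChain ω₂ lam β γ).hamiltonian N y)) → ∀ n : ℕ,
      (∀ x, Integrable f ((K ^ n) x)) ∧ (Continuous fun x => ∫ y, f y ∂((K ^ n) x)) := by
    intro f hf Cf hCf hfb n
    have hwin : ∀ _y : Unit, 0 < T + δ / 2 ∧ T + δ / 2 ≤ 2 * T ∧ 0 < T - δ / 2 ∧ T - δ / 2 ≤ 2 * T :=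
      fun _ => ⟨hL0, hL', hR0, hR'⟩
    obtain ⟨_Cp', _hCp', hk⟩ := continuous_integral_embeddedFlipKernel_pow_param hω hl hβ hγ hN hT hϑ h2ϑT
      (Y := Unit) (τL := fun _ => T + δ / 2) (τR := fun _ => T - δ / 2) continuous_const continuous_const hwin hr
    obtain ⟨hIB, hc⟩ := hk (F := fun _ => f) (hf.comp continuous_snd) hCf (fun _ y => hfb y) n
    have hu : Continuous fun x : PhaseSpace N => ((), x) := (continuous_const (y := ())).prodMk continuous_id
    have h2 := hc.comp hu
    exact ⟨fun x => (hIB () x).1, h2⟩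
  -- `π_T`-integrability of continuous weighted functions
  have hπT : ∀ {f : PhaseSpace N → ℝ}, Continuous f → ∀ {Cf : ℝ},
      (∀ y, |f y| ≤ Cf * Real.exp (ϑ * (pinnedChain ω₂ lam β γ).hamiltonian N y)) → Integrable f ((pinnedChain ω₂ lam β γ).gibbsMeasure N T) := by
    intro f hf Cf hfb
    refine integrable_gibbs_of_abs_le hω hl hβ hT h2ϑT hf (C := Cf) fun y => (hfb y).trans ?_
    have hCf : 0 ≤ Cf := by
      have := (abs_nonneg _).trans (hfb 0); exact nonneg_of_mul_nonneg_left this (Real.exp_pos _)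
    exact mul_le_mul_of_nonneg_left (Real.exp_le_exp.2 (by
      nlinarith [pinnedChain_hamiltonian_nonneg hω.le hl.le hβ.le γ N y])) hCf
  -- `ψ = R φ`
  obtain ⟨hφR, hψc, hψb⟩ := hRfacts hφ hC hφb
  set ψ : PhaseSpace N → ℝ := fun y => ∫ z, φ z ∂(Rk y) with hψ
  have hψb' : ∀ y, |ψ y| ≤ C * CR * Real.exp (ϑ * (pinnedChain ω₂ lam β γ).hamiltonian N y) := hψb
  have hM : 0 ≤ C * CR := by positivity
  -- the Poisson package for `ψ` (folded to the local names)
  obtain ⟨hπV, hPψ⟩ := hP _ _ (bath_window hT hδ).2.2.2.2.1 hL' (bath_window hT hδ).2.2.2.2.2 hR' π hπ hinv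
  obtain ⟨hgeo0, -, hχc0, hχb0, hpois0⟩ := hPψ ψ hψc (C * CR) hM hψb'
  set χ : PhaseSpace N → ℝ := fun x => ∑' n : ℕ, ((∫ y, ψ y ∂((K ^ n) x)) - ∫ y, ψ y ∂π) with hχ
  have hgeo : ∀ (n : ℕ) (x : PhaseSpace N), |(∫ y, ψ y ∂((K ^ n) x)) - ∫ y, ψ y ∂π| ≤
      Cg * abar ^ n * (C * CR) * Real.exp (ϑ * (pinnedChain ω₂ lam β γ).hamiltonian N x) := hgeo0
  have hχc : Continuous χ := hχc0
  have hχb' : ∀ y, |χ y| ≤ Cg / (1 - abar) * (C * CR) * Real.exp (ϑ * (pinnedChain ω₂ lam β γ).hamiltonian N y) := hχb0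
  have hpois : ∀ x, χ x - ∫ y, χ y ∂(K x) = ψ x - ∫ y, ψ y ∂π := hpois0
  clear hgeo0 hχc0 hχb0 hpois0 hPψ
  have h1a : 0 < 1 - abar := by linarith
  have hCχ : 0 ≤ Cg / (1 - abar) * (C * CR) := by positivity
  -- `g = p_0² - p_{N-1}²` and its integrability facts
  set g : PhaseSpace N → ℝ := fun x => x.2 ⟨0, hN⟩ ^ 2 - x.2 ⟨N - 1, by omega⟩ ^ 2 with hg
  have hgc : Continuous g := by rw [hg]; fun_prop
  have hgI : Integrable g ((pinnedChain ω₂ lam β γ).gibbsMeasure N T) := hIg.mono' hgc.aestronglyMeasurable (Eventually.of_forall fun y => by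
    rw [Real.norm_eq_abs]
    have hp : |g y| ≤ 1 + y.2 ⟨0, hN⟩ ^ 2 + y.2 ⟨N - 1, by omega⟩ ^ 2 := by
      rw [hg]; dsimp only
      rw [abs_le]; constructor <;> nlinarith [sq_nonneg (y.2 ⟨0, hN⟩), sq_nonneg (y.2 ⟨N - 1, by omega⟩)]
    refine hp.trans ?_
    have h1 := hW1 y
    have h0 : 0 ≤ 1 + y.2 ⟨0, hN⟩ ^ 2 + y.2 ⟨N - 1, by omega⟩ ^ 2 := by positivity
    nlinarith)
  have hg0 : ∫ x, g x ∂((pinnedChain ω₂ lam β γ).gibbsMeasure N T) = 0 := integral_gibbs_oddMoment hω hl hβ hγ hN hT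
  have hgf' : ∀ {f : PhaseSpace N → ℝ}, Continuous f → ∀ {Cf : ℝ}, 0 ≤ Cf →
      (∀ y, |f y| ≤ Cf * Real.exp (ϑ * (pinnedChain ω₂ lam β γ).hamiltonian N y)) →
      Integrable (fun x => g x * f x) ((pinnedChain ω₂ lam β γ).gibbsMeasure N T) ∧
        |∫ x, g x * f x ∂((pinnedChain ω₂ lam β γ).gibbsMeasure N T)| ≤ Cf * Ig :=
    fun hf _ hCf hfb => hgf hf hCf hfb
  have hgabs : ∀ x : PhaseSpace N, |g x| ≤ 1 + x.2 ⟨0, hN⟩ ^ 2 + x.2 ⟨N - 1, by omega⟩ ^ 2 := fun x => by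
    rw [hg]; dsimp only
    rw [abs_le]; constructor <;> nlinarith [sq_nonneg (x.2 ⟨0, hN⟩), sq_nonneg (x.2 ⟨N - 1, by omega⟩)]
  -- the centred terms `fₙ = Kⁿψ - π(ψ)` and `π_T(g · Kⁿψ) = π_T(g · fₙ)`
  have hfc : ∀ n : ℕ, Continuous fun x => (∫ y, ψ y ∂((K ^ n) x)) - ∫ y, ψ y ∂π := fun n =>
    (hKfacts hψc hM hψb' n).2.sub continuous_const
  have hfI : ∀ n : ℕ, Integrable (fun x => g x * ((∫ y, ψ y ∂((K ^ n) x)) - ∫ y, ψ y ∂π)) ((pinnedChain ω₂ lam β γ).gibbsMeasure N T) ∧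
      |∫ x, g x * ((∫ y, ψ y ∂((K ^ n) x)) - ∫ y, ψ y ∂π) ∂((pinnedChain ω₂ lam β γ).gibbsMeasure N T)| ≤ Cg * abar ^ n * (C * CR) * Ig :=
    fun n => hgf' (hfc n) (mul_nonneg (mul_nonneg hCg (pow_nonneg h0.le n)) hM) (fun x => hgeo n x)
  have hsplit : ∀ n : ℕ, ∫ x, g x * (∫ y, ψ y ∂((K ^ n) x)) ∂((pinnedChain ω₂ lam β γ).gibbsMeasure N T) =
      ∫ x, g x * ((∫ y, ψ y ∂((K ^ n) x)) - ∫ y, ψ y ∂π) ∂((pinnedChain ω₂ lam β γ).gibbsMeasure N T) := by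
    intro n
    have e : ∀ x : PhaseSpace N, g x * (∫ y, ψ y ∂((K ^ n) x)) =
        g x * ((∫ y, ψ y ∂((K ^ n) x)) - ∫ y, ψ y ∂π) + (∫ y, ψ y ∂π) * g x := fun x => by ring
    simp_rw [e]
    rw [integral_add (hfI n).1 (hgI.const_mul _), integral_const_mul, hg0, mul_zero, add_zero]
  refine ⟨fun n => ?_, ?_⟩
  · rw [hsplit n]
    refine (hfI n).2.trans (le_of_eq ?_)
    rw [hIgdef]; ring
  -- the Poisson solution `χ`, `Kχ` and `u = Q χ`
  obtain ⟨hKχI, hKχc⟩ := hKfacts hχc hCχ hχb' 1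
  have hKχI' : ∀ x, Integrable χ (K x) := fun x => by have h := hKχI x; rwa [pow_one] at h
  have hKχc' : Continuous fun x => ∫ y, χ y ∂(K x) := by simpa only [pow_one] using hKχc
  have hKχb : ∀ x, |∫ y, χ y ∂(K x)| ≤ Cg / (1 - abar) * (C * CR) * (1 + Cp.toReal) * Real.exp (ϑ * (pinnedChain ω₂ lam β γ).hamiltonian N x) := by
    intro x
    have h := (integrable_abs_integral_le_of_lintegral_le hWm (fun z => (Real.exp_pos _).le)
      (ENNReal.add_ne_top.2 ⟨ENNReal.ofReal_ne_top, hCp⟩) (by simpa only [pow_one] using hpowK 1 x)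
      hχc.aestronglyMeasurable hCχ hχb').2
    rw [ENNReal.toReal_add ENNReal.ofReal_ne_top hCp, ENNReal.toReal_ofReal (Real.exp_pos _).le] at h
    refine h.trans ?_
    nlinarith [hW1 x, mul_nonneg hCχ (ENNReal.toReal_nonneg (a := Cp))]
  set u : PhaseSpace N → ℝ := fun y => (N : ℝ)⁻¹ * ∑ i : Fin N, χ (momentumFlip i y) with hu
  have huc : Continuous u := continuous_const.mul (continuous_finsetSum _ fun i _ => hχc.comp (continuous_momentumFlip i))
  have hub : ∀ y, |u y| ≤ Cg / (1 - abar) * (C * CR) * Real.exp (ϑ * (pinnedChain ω₂ lam β γ).hamiltonian N y) :=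
    (flipAverage_continuous_bound (Y := Unit) hN (F := fun _ => χ) (hχc.comp continuous_snd)
      (C := Cg / (1 - abar) * (C * CR)) (fun _ y => hχb' y)).2 ()
  obtain ⟨huR, hRuc, hRub⟩ := hRfacts huc hCχ hub
  have hKu : ∀ x, ∫ y, χ y ∂(K x) = ∫ y, u y ∂(Rk x) := fun x => integral_embeddedFlipKernel_eq Sg hN r x (hKχI' x)
  -- (F6) the Poisson equation integrated against `π_T`
  have hPois : (∫ x, χ x ∂((pinnedChain ω₂ lam β γ).gibbsMeasure N T)) - ∫ x, (∫ y, χ y ∂(K x)) ∂((pinnedChain ω₂ lam β γ).gibbsMeasure N T) =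
      (∫ x, ψ x ∂((pinnedChain ω₂ lam β γ).gibbsMeasure N T)) - ∫ y, ψ y ∂π := by
    rw [← integral_sub (hπT hχc hχb') (hπT hKχc' hKχb), integral_congr_ae (Eventually.of_forall hpois),
      integral_sub (hπT hψc hψb') (integrable_const _), integral_const, probReal_univ, one_smul]
  -- (F7) `π_T(u) = π_T(χ)`
  have hQinv : ∫ x, u x ∂((pinnedChain ω₂ lam β γ).gibbsMeasure N T) = ∫ x, χ x ∂((pinnedChain ω₂ lam β γ).gibbsMeasure N T) :=
    integral_gibbs_flipAverage hN fun i => hπT (hχc.comp (continuous_momentumFlip i)) (Cf := Cg / (1 - abar) * (C * CR))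
      fun y => by have h := hχb' (momentumFlip i y); rwa [OscillatorChain.hamiltonian_momentumFlip] at h
  -- (F8), (F9) the resolvent response identity for `u` and for `φ`
  have hRRIu : (∫ x, (∫ y, u y ∂(Rk x)) ∂((pinnedChain ω₂ lam β γ).gibbsMeasure N T)) -
      ∫ x, u x ∂((pinnedChain ω₂ lam β γ).gibbsMeasure N T) = δ * (γ / (2 * T ^ 2)) * r⁻¹ *
        ∫ x, g x * (∫ y, u y ∂(Rk x)) ∂((pinnedChain ω₂ lam β γ).gibbsMeasure N T) :=
    rri_gibbs hω hl hβ hγ hN hT hϑ hϑT hδ hr huc hub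
  have hRRIφ : (∫ x, ψ x ∂((pinnedChain ω₂ lam β γ).gibbsMeasure N T)) -
      ∫ x, φ x ∂((pinnedChain ω₂ lam β γ).gibbsMeasure N T) = δ * (γ / (2 * T ^ 2)) * r⁻¹ *
        ∫ x, g x * ψ x ∂((pinnedChain ω₂ lam β γ).gibbsMeasure N T) :=
    rri_gibbs hω hl hβ hγ hN hT hϑ hϑT hδ hr hφ hφb
  -- (F10) `π_T(g · Kχ) = π_T(g χ) - π_T(g ψ)`
  obtain ⟨hgχI, -⟩ := hgf' hχc hCχ hχb'
  obtain ⟨hgψI, -⟩ := hgf' hψc hM hψb'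
  have hgK : ∫ x, g x * (∫ y, u y ∂(Rk x)) ∂((pinnedChain ω₂ lam β γ).gibbsMeasure N T) =
      (∫ x, g x * χ x ∂((pinnedChain ω₂ lam β γ).gibbsMeasure N T)) - ∫ x, g x * ψ x ∂((pinnedChain ω₂ lam β γ).gibbsMeasure N T) := by
    have e : ∀ x, g x * (∫ y, u y ∂(Rk x)) = g x * χ x - g x * ψ x + (∫ y, ψ y ∂π) * g x := fun x => by
      have h2 : ∫ y, χ y ∂(K x) = χ x - (ψ x - ∫ y, ψ y ∂π) := by rw [← hpois x]; ring
      rw [← hKu x, h2]; ring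
    have hsubI : Integrable (fun x => g x * χ x - g x * ψ x) ((pinnedChain ω₂ lam β γ).gibbsMeasure N T) :=
      hgχI.sub hgψI
    simp_rw [e]
    rw [integral_add hsubI (hgI.const_mul _), integral_sub hgχI hgψI, integral_const_mul, hg0,
      mul_zero, add_zero]
  -- (F11) `(π R)(φ) = π(ψ)`
  have hμφ : ∫ x, φ x ∂(π.bind Rk) = ∫ y, ψ y ∂π := by
    have hlin : ∫⁻ x, ENNReal.ofReal (Real.exp (ϑ * (pinnedChain ω₂ lam β γ).hamiltonian N x)) ∂(π.bind Rk) ≤ a * ENNReal.ofReal Cπ + b := by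
      refine (MarkovChain.lintegral_bind_le_of_lyapunov Rk hWm.ennreal_ofReal hRes π).trans ?_
      rw [measure_univ, mul_one]
      gcongr
    have hint : Integrable φ (π.bind Rk) :=
      (integrable_abs_integral_le_of_lintegral_le hWm (fun z => (Real.exp_pos _).le)
        (ENNReal.add_ne_top.2 ⟨ENNReal.mul_ne_top ha.ne_top ENNReal.ofReal_ne_top, hb⟩) hlin
        hφ.aestronglyMeasurable hC hφb).1
    exact Harris.integral_comp_measure Rk π hint
  -- (F13) `π_T(g χ) = ∑ₙ π_T(g · Kⁿψ)`
  have hseries : ∫ x, g x * χ x ∂((pinnedChain ω₂ lam β γ).gibbsMeasure N T) = ∑' n : ℕ, ∫ x, g x * (∫ y, ψ y ∂((K ^ n) x)) ∂((pinnedChain ω₂ lam β γ).gibbsMeasure N T) := by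
    simp_rw [hsplit]
    have e : ∀ x, g x * χ x = ∑' n : ℕ, g x * ((∫ y, ψ y ∂((K ^ n) x)) - ∫ y, ψ y ∂π) := fun x => by
      rw [hχ]; exact (tsum_mul_left).symm
    simp_rw [e]
    refine integral_tsum (fun n => ((hgc.mul (hfc n)).aestronglyMeasurable)) ?_
    have hL1 : ∀ n : ℕ, ∫⁻ x, ‖g x * ((∫ y, ψ y ∂((K ^ n) x)) - ∫ y, ψ y ∂π)‖ₑ ∂((pinnedChain ω₂ lam β γ).gibbsMeasure N T) ≤
        ENNReal.ofReal (Cg * abar ^ n * (C * CR) * Ig) := by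
      intro n
      rw [← ofReal_integral_norm_eq_lintegral_enorm (hfI n).1]
      refine ENNReal.ofReal_le_ofReal ?_
      simp_rw [Real.norm_eq_abs]
      calc ∫ x, |g x * ((∫ y, ψ y ∂((K ^ n) x)) - ∫ y, ψ y ∂π)| ∂((pinnedChain ω₂ lam β γ).gibbsMeasure N T)
          ≤ ∫ x, Cg * abar ^ n * (C * CR) * ((1 + x.2 ⟨0, hN⟩ ^ 2 + x.2 ⟨N - 1, by omega⟩ ^ 2) *
              Real.exp (ϑ * (pinnedChain ω₂ lam β γ).hamiltonian N x)) ∂((pinnedChain ω₂ lam β γ).gibbsMeasure N T) := by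
            refine integral_mono (hfI n).1.abs (hIg.const_mul _) fun x => ?_
            rw [abs_mul]
            have hq : (0 : ℝ) ≤ 1 + x.2 ⟨0, hN⟩ ^ 2 + x.2 ⟨N - 1, by omega⟩ ^ 2 := by positivity
            calc |g x| * |(∫ y, ψ y ∂((K ^ n) x)) - ∫ y, ψ y ∂π|
                ≤ (1 + x.2 ⟨0, hN⟩ ^ 2 + x.2 ⟨N - 1, by omega⟩ ^ 2) * (Cg * abar ^ n * (C * CR) * Real.exp (ϑ * (pinnedChain ω₂ lam β γ).hamiltonian N x)) :=
                  mul_le_mul (hgabs x) (hgeo n x) (abs_nonneg _) hq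
              _ = _ := by ring
        _ = Cg * abar ^ n * (C * CR) * Ig := by rw [integral_const_mul]
    refine ne_top_of_le_ne_top ?_ (ENNReal.tsum_le_tsum hL1)
    have hsumI : Summable fun n : ℕ => Cg * abar ^ n * (C * CR) * Ig :=
      ((summable_geometric_of_lt_one h0.le h1).mul_left (Cg * (C * CR) * Ig)).congr fun n => by ring
    rw [← ENNReal.ofReal_tsum_of_nonneg (fun n => by
      have := mul_nonneg (mul_nonneg (mul_nonneg hCg (pow_nonneg h0.le n)) hM) hIg0; exact this) hsumI]
    exact ENNReal.ofReal_ne_top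
  have hKR : ∫ x, (∫ y, χ y ∂(K x)) ∂((pinnedChain ω₂ lam β γ).gibbsMeasure N T) =
      ∫ x, (∫ y, u y ∂(Rk x)) ∂((pinnedChain ω₂ lam β γ).gibbsMeasure N T) :=
    integral_congr_ae (Eventually.of_forall hKu)
  -- assemble
  rw [hμφ, ← hseries]
  rw [hgK] at hRRIu
  linear_combination hPois + hRRIu + hRRIφ + hQinv + hKR

end Exact

/-- Registered helper sub-goal `helper_responseDensityNoisyDysonExactResponse` of stmt-AtomisticToContinuum-11975
(fully quantified, notation-free one-line form of the main theorem of this file). -/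
theorem helper_responseDensityNoisyDysonExactResponse : ∀ (ω₂ lam β γ : ℝ) (hω : 0 < ω₂) (hl : 0 < lam) (hβ : 0 < β) (hγ : 0 < γ) (N : ℕ) (hN : 0 < N) (T : ℝ) (hT : 0 < T) (ϑ : ℝ) (hϑ : 0 < ϑ) (h2ϑT : 2 * ϑ < 1 / (2 * T)) (r : ℝ) (hr : 0 < r), ∃ abar CB : ℝ, 0 < abar ∧ abar < 1 ∧ 0 ≤ CB ∧ ∀ (δ : ℝ) (hδ : |δ| < T) (π : MeasureTheory.Measure (Literature.MathematicalPhysics.KineticTheory.HeatConduction.PhaseSpace N)), MeasureTheory.IsProbabilityMeasure π → ProbabilityTheory.Kernel.Invariant ((Literature.MathematicalPhysics.KineticTheory.HeatConduction.pinnedChainSemigroup hω hl.le hβ.le hγ.le hN ((half_pos hT).le.trans (Summit.AtomisticToContinuum.FouriersLaw.Theorems.NoiseLocality.StubResponseDensityNoisy.Dyson.bath_window hT hδ).2.2.2.2.1) ((half_pos hT).le.trans (Summit.AtomisticToContinuum.FouriersLaw.Theorems.NoiseLocality.StubResponseDensityNoisy.Dyson.bath_window hT hδ).2.2.2.2.2)).embeddedFlipKernel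 r) π → ∀ (φ : Literature.MathematicalPhysics.KineticTheory.HeatConduction.PhaseSpace N → ℝ), Continuous φ → ∀ (C : ℝ), 0 ≤ C → (∀ y, |φ y| ≤ C * Real.exp (ϑ * (Literature.MathematicalPhysics.KineticTheory.HeatConduction.pinnedChain ω₂ lam β γ).hamiltonian N y)) → (∀ n : ℕ, |∫ x, (x.2 ⟨0, hN⟩ ^ 2 - x.2 ⟨N - 1, by omega⟩ ^ 2) * (∫ y, (∫ z, φ z ∂((Literature.MathematicalPhysics.KineticTheory.HeatConduction.pinnedChainSemigroup hω hl.le hβ.le hγ.le hN ((half_pos hT).le.trans (Summit.AtomisticToContinuum.FouriersLaw.Theorems.NoiseLocality.StubResponseDensityNoisy.Dyson.bath_window hT hδ).2.2.2.2.1) ((half_pos hT).le.trans (Summit.AtomisticToContinuum.FouriersLaw.Theorems.NoiseLocality.StubResponseDensityNoisy.Dyson.bath_window hT hδ).2.2.2.2.2)).resolventKernel r y)) ∂((((Literature.MathematicalPhysics.KineticTheory.HeatConduction.pinnedChainSemigroup hω hl.le hβ.le hγ.le hN ((half_pos hT).le.trans (Summit.AtomisticToContinuum.FouriersLaw.Theorems.NoiseLocality.StubResponseDensityNoisy.Dyson.bath_window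 hT hδ).2.2.2.2.1) ((half_pos hT).le.trans (Summit.AtomisticToContinuum.FouriersLaw.Theorems.NoiseLocality.StubResponseDensityNoisy.Dyson.bath_window hT hδ).2.2.2.2.2)).embeddedFlipKernel r) ^ n) x)) ∂((Literature.MathematicalPhysics.KineticTheory.HeatConduction.pinnedChain ω₂ lam β γ).gibbsMeasure N T)| ≤ CB * C * abar ^ n) ∧ (∫ x, φ x ∂(π.bind ((Literature.MathematicalPhysics.KineticTheory.HeatConduction.pinnedChainSemigroup hω hl.le hβ.le hγ.le hN ((half_pos hT).le.trans (Summit.AtomisticToContinuum.FouriersLaw.Theorems.NoiseLocality.StubResponseDensityNoisy.Dyson.bath_window hT hδ).2.2.2.2.1) ((half_pos hT).le.trans (Summit.AtomisticToContinuum.FouriersLaw.Theorems.NoiseLocality.StubResponseDensityNoisy.Dyson.bath_window hT hδ).2.2.2.2.2)).resolventKernel r))) - ∫ x, φ x ∂((Literature.MathematicalPhysics.KineticTheory.HeatConduction.pinnedChain ω₂ lam β γ).gibbsMeasure N T) = δ * (γ / (2 * T ^ 2)) * r⁻¹ * ∑' n : ℕ, ∫ x, (x.2 ⟨0, hN⟩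 ^ 2 - x.2 ⟨N - 1, by omega⟩ ^ 2) * (∫ y, (∫ z, φ z ∂((Literature.MathematicalPhysics.KineticTheory.HeatConduction.pinnedChainSemigroup hω hl.le hβ.le hγ.le hN ((half_pos hT).le.trans (Summit.AtomisticToContinuum.FouriersLaw.Theorems.NoiseLocality.StubResponseDensityNoisy.Dyson.bath_window hT hδ).2.2.2.2.1) ((half_pos hT).le.trans (Summit.AtomisticToContinuum.FouriersLaw.Theorems.NoiseLocality.StubResponseDensityNoisy.Dyson.bath_window hT hδ).2.2.2.2.2)).resolventKernel r y)) ∂((((Literature.MathematicalPhysics.KineticTheory.HeatConduction.pinnedChainSemigroup hω hl.le hβ.le hγ.le hN ((half_pos hT).le.trans (Summit.AtomisticToContinuum.FouriersLaw.Theorems.NoiseLocality.StubResponseDensityNoisy.Dyson.bath_window hT hδ).2.2.2.2.1) ((half_pos hT).le.trans (Summit.AtomisticToContinuum.FouriersLaw.Theorems.NoiseLocality.StubResponseDensityNoisy.Dyson.bath_window hT hδ).2.2.2.2.2)).embeddedFlipKernel r) ^ n) x)) ∂((Literature.MathematicalPhysics.KineticTheory.HeatConduction.pinnedChain ω₂ lam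 β γ).gibbsMeasure N T) :=
  fun _ _ _ _ hω hl hβ hγ _ hN _ hT _ hϑ h2ϑT _ hr => exact_response_identity hω hl hβ hγ hN hT hϑ h2ϑT hr

end Summit.AtomisticToContinuum.FouriersLaw.Theorems.NoiseLocality.StubResponseDensityNoisy.Dyson

end
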